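import Literature.NumberTheory.EllipticCurves.KugaSatoVariety
import HarnessLib

/-!
# A base change of elliptic curves is a homomorphism over the base

Topic: `Literature/NumberTheory/EllipticCurves`. Companion to `KugaSatoVariety.lean`, whose
predicate `EllCurveOver.IsBaseChangeVia C' C g G` records that `G : E' → E` over `g : S' → S` is
cartesian and compatible with the identity sections and the group laws (Katz–Mazur (2.1)). This
file draws the standard consequences used when automorphisms of `E'^m` and `E^m` (translations by
sections, inversions; Deninger–Scholl 5.3 (i)) are compared along a base change:

* `IsBaseChangeVia.homOver` — `G` as a morphism of `S`-schemes `(E' → S' → S) ⟶ E`;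
* `IsBaseChangeVia.pushMonoidHom h X'` — for an `S'`-scheme `X'`, the map
  `E'(X') → E(X' → S' → S)`, `f ↦ f ≫ G`, is a **group homomorphism** for the group structures
  induced by the group objects `E'` and `E` (`push_mul`, `push_one`, `push_inv`, `push_pow`);
* `IsBaseChangeVia.inv_left_comp` — `G` is compatible with the inversions:
  `ι[E'] ≫ G = G ≫ ι[E]` (not part of the definition; it follows because `f ↦ f ≫ G` is a
  homomorphism and `ι = (𝟙)⁻¹`);
* `LevelStructure.IsBaseChangeVia.section_left_comp` — a base change of level structures carries
  `φ'(a, b) = P'^a Q'^b` to `φ(a, b)`: `φ'(a,b) ≫ G = g ≫ φ(a,b)`.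

Implementation note: as in `Mathlib.CategoryTheory.Monoidal.Cartesian.Over`, statements living
over the identifications `((Over.map g).obj X').left = X'.left`, `(𝟙_ (Over S)).left = S` are
proved with `backward.isDefEq.respectTransparency false`. No named facts.

## References

* N. Katz, B. Mazur, *Arithmetic moduli of elliptic curves* (1985), (2.1), (3.1). [KatzMazur1985]
* C. Deninger, A. J. Scholl, *The Beilinson conjectures* (1991), 5.3 (i). [DeningerScholl1991]
-/

universe u

open CategoryTheory Limits AlgebraicGeometry MonoidalCategory CartesianMonoidalCategory
open scoped MonObj

noncomputable section

namespace Literature.NumberTheory.EllipticCurves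

namespace EllCurveOver

namespace IsBaseChangeVia

variable {S S' : Scheme.{u}} {C' : EllCurveOver S'} {C : EllCurveOver S} {g : S' ⟶ S}
  {G : C'.E.left ⟶ C.E.left} (h : C'.IsBaseChangeVia C g G)

include h

/-- The square commutes: `G ≫ (E → S) = (E' → S') ≫ g`. [folklore] -/
theorem w : G ≫ C.E.hom = C'.E.hom ≫ g := h.1

/-- The square `(G, g)` is cartesian. [folklore] -/
theorem isPullback : IsPullback G C'.E.hom C.E.hom g := h.2.1

/-- `G` carries the identity section of `E'` to that of `E`. [folklore] -/
theorem one_left_comp : η[C'.E].left ≫ G = g ≫ η[C.E].left := h.2.2.1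

/-- `G` is compatible with the group laws. [folklore] -/
theorem mul_left_comp :
    μ[C'.E].left ≫ G =
      pullback.map C'.E.hom C'.E.hom C.E.hom C.E.hom G G g h.w.symm h.w.symm ≫ μ[C.E].left :=
  h.2.2.2

/-- `G` as a morphism of `S`-schemes from `E' → S' → S` (i.e. `(Over.map g).obj E'`) to `E`.
[folklore] -/
def homOver : (Over.map g).obj C'.E ⟶ C.E := Over.homMk G h.w

/-- The underlying morphism of `homOver` is `G`. [folklore] -/
@[simp]
theorem homOver_left : h.homOver.left = G := rfl

variable (X' : Over S')

/-- Push-forward of points along the base change: a point `f : X' → E'` over `S'` gives the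
point `f ≫ G : X' → E` over `S` (with `X'` an `S`-scheme through `g`). [folklore] -/
def push (f : X' ⟶ C'.E) : (Over.map g).obj X' ⟶ C.E := (Over.map g).map f ≫ h.homOver

/-- The underlying morphism of `push f` is `f ≫ G`. [folklore] -/
@[simp]
theorem push_left (f : X' ⟶ C'.E) : (h.push X' f).left = f.left ≫ G := rfl

-- `((Over.map g).obj X').left = X'.left`, `(_ ⊗ _).left = pullback _ _` by unfolding.
set_option backward.isDefEq.respectTransparency false in
/-- `f ↦ f ≫ G` is multiplicative: `G` intertwines the group laws (Katz–Mazur (2.1): the base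
change is an isomorphism of group schemes `E' ≅ S' ×_S E`). [cite: KatzMazur1985, (2.1)] -/
theorem push_mul (f₁ f₂ : X' ⟶ C'.E) : h.push X' (f₁ * f₂) = h.push X' f₁ * h.push X' f₂ := by
  ext
  rw [push_left, Hom.mul_def, Hom.mul_def, Over.comp_left, Over.comp_left, Category.assoc,
    h.mul_left_comp, ← Category.assoc]
  congr 1
  apply pullback.hom_ext
  · rw [Category.assoc, pullback.lift_fst, Over.lift_left, Over.lift_left, pullback.lift_fst,
      pullback.lift_fst_assoc, push_left]
  · rw [Category.assoc, pullback.lift_snd, Over.lift_left, Over.lift_left, pullback.lift_snd,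
      pullback.lift_snd_assoc, push_left]

-- as above.
set_option backward.isDefEq.respectTransparency false in
/-- `f ↦ f ≫ G` preserves the unit: `G` carries the identity section to the identity section.
[folklore] -/
theorem push_one : h.push X' (1 : X' ⟶ C'.E) = 1 := by
  ext
  rw [push_left, Hom.one_def, Hom.one_def, Over.comp_left, Over.comp_left, Category.assoc,
    h.one_left_comp, Over.toUnit_left, Over.toUnit_left, Over.map_obj_hom, Category.assoc]

/-- **`f ↦ f ≫ G` is a group homomorphism `E'(X') → E(X')`** (`X'` over `S` through `g`).
[cite: KatzMazur1985, (2.1)] -/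
def pushMonoidHom : (X' ⟶ C'.E) →* ((Over.map g).obj X' ⟶ C.E) where
  toFun := h.push X'
  map_one' := h.push_one X'
  map_mul' := h.push_mul X'

/-- Unfolding of `pushMonoidHom`. [folklore] -/
@[simp]
theorem pushMonoidHom_apply (f : X' ⟶ C'.E) : h.pushMonoidHom X' f = h.push X' f := rfl

/-- `f ↦ f ≫ G` commutes with inverses. [folklore] -/
theorem push_inv (f : X' ⟶ C'.E) : h.push X' f⁻¹ = (h.push X' f)⁻¹ :=
  map_inv (h.pushMonoidHom X') f

/-- `f ↦ f ≫ G` commutes with powers. [folklore] -/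
theorem push_pow (f : X' ⟶ C'.E) (n : ℕ) : h.push X' (f ^ n) = h.push X' f ^ n :=
  map_pow (h.pushMonoidHom X') f n

-- `((Over.map g).obj E').left = E'.left` by unfolding.
set_option backward.isDefEq.respectTransparency false in
/-- **`G` is compatible with the inversions**: `ι[E'] ≫ G = G ≫ ι[E]`. This is not part of
`IsBaseChangeVia` but follows from it: `ι[E'] = (𝟙 E')⁻¹` in the group `E'(E')`, and
`f ↦ f ≫ G` is a homomorphism. [folklore] -/
theorem inv_left_comp : ι[C'.E].left ≫ G = G ≫ ι[C.E].left := by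
  have key := congr_arg CommaMorphism.left (h.push_inv C'.E (𝟙 C'.E))
  simp only [push_left, Hom.inv_def, Category.id_comp, Over.comp_left, Over.id_left] at key
  exact key

/-- The inverse of a point is carried to the inverse: `(f⁻¹) ≫ G = (f ≫ G)⁻¹` on underlying
morphisms, i.e. `f.left ≫ ι' ≫ G = f.left ≫ G ≫ ι`. [folklore] -/
theorem inv_left_comp_of (f : X' ⟶ C'.E) :
    (f⁻¹).left ≫ G = f.left ≫ G ≫ ι[C.E].left := by
  rw [Hom.inv_def, Over.comp_left, Category.assoc, h.inv_left_comp]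

end IsBaseChangeVia

-- `(𝟙_ (Over S')).left = S'` and `((Over.map g).obj (𝟙_ (Over S'))).hom = 𝟙 S' ≫ g` by unfolding.
set_option backward.isDefEq.respectTransparency false in
/-- A section `P` of `E → S` pulled back to the `S`-scheme `S' → S`: the point
`toUnit ≫ P : (S' → S) ⟶ E` of `E` over `S`; its underlying morphism is `g ≫ P`. [folklore] -/
theorem toUnit_map_tensorUnit_comp_left {S S' : Scheme.{u}} (g : S' ⟶ S) {C : EllCurveOver S}
    (P : C.Sections) :
    (toUnit ((Over.map g).obj (𝟙_ (Over S'))) ≫ P).left = g ≫ P.left := by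
  rw [Over.comp_left, Over.toUnit_left, Over.map_obj_hom]
  dsimp only [Over.tensorUnit_hom, Over.tensorUnit_left]
  rw [Category.id_comp]

namespace LevelStructure.IsBaseChangeVia

variable {S S' : Scheme.{u}} {C' : EllCurveOver S'} {C : EllCurveOver S} {N : ℕ}
  {φ' : LevelStructure N C'} {φ : LevelStructure N C} {g : S' ⟶ S} {G : C'.E.left ⟶ C.E.left}
  (h : φ'.IsBaseChangeVia φ g G)

include h

/-- The underlying base change of elliptic curves. [folklore] -/
theorem curve : C'.IsBaseChangeVia C g G := h.1

/-- `G` carries `P'` to `P`. [folklore] -/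
theorem P_left_comp : φ'.P.left ≫ G = g ≫ φ.P.left := h.2.1

/-- `G` carries `Q'` to `Q`. [folklore] -/
theorem Q_left_comp : φ'.Q.left ≫ G = g ≫ φ.Q.left := h.2.2

-- as above.
set_option backward.isDefEq.respectTransparency false in
/-- Under a base change of level structures, the push-forward of `P'` is the pull-back of `P`.
[folklore] -/
theorem push_P : h.curve.push (𝟙_ (Over S')) φ'.P = toUnit _ ≫ φ.P :=
  Over.OverMorphism.ext
    (by rw [IsBaseChangeVia.push_left, h.P_left_comp, toUnit_map_tensorUnit_comp_left g])

-- as above.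
set_option backward.isDefEq.respectTransparency false in
/-- Under a base change of level structures, the push-forward of `Q'` is the pull-back of `Q`.
[folklore] -/
theorem push_Q : h.curve.push (𝟙_ (Over S')) φ'.Q = toUnit _ ≫ φ.Q :=
  Over.OverMorphism.ext
    (by rw [IsBaseChangeVia.push_left, h.Q_left_comp, toUnit_map_tensorUnit_comp_left g])

/-- Under a base change of level structures, the push-forward of `φ'(a, b) = P'^a Q'^b` is the
pull-back of `φ(a, b)` (because `f ↦ f ≫ G` is a homomorphism). [folklore] -/
theorem push_section_ (ab : ZMod N × ZMod N) :
    h.curve.push (𝟙_ (Over S')) (φ'.section_ ab) = toUnit _ ≫ φ.section_ ab := by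
  rw [section_, section_, IsBaseChangeVia.push_mul, IsBaseChangeVia.push_pow,
    IsBaseChangeVia.push_pow, h.push_P, h.push_Q, MonObj.comp_mul, MonObj.comp_pow, MonObj.comp_pow]

-- as above.
set_option backward.isDefEq.respectTransparency false in
/-- **A base change of level structures carries `φ'(a, b)` to `φ(a, b)`**:
`φ'(a, b) ≫ G = g ≫ φ(a, b)` on underlying schemes — the compatibility needed to compare the
translations `KugaSato.transl` by `N`-torsion sections on `E'^m` and on `E^m`
(Deninger–Scholl 5.3 (i)) along `G^m`. [cite: KatzMazur1985, (3.1)] -/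
theorem section_left_comp (ab : ZMod N × ZMod N) :
    (φ'.section_ ab).left ≫ G = g ≫ (φ.section_ ab).left := by
  rw [← IsBaseChangeVia.push_left h.curve, h.push_section_, toUnit_map_tensorUnit_comp_left g]

end LevelStructure.IsBaseChangeVia

end EllCurveOver

end Literature.NumberTheory.EllipticCurves

end
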